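import Literature.MathematicalPhysics.QuantumFieldTheory.ConformalBootstrap3D.PointKernelK34Data

/-!
# K34 certificate, kernel block file M5: (M) rows `54 ≤ j < 68` of `mrows`, in 7 row groups

`decide` by kernel reduction (no `native_decide`, no extra axioms) of the block checker of
`PointKernel` on the literal data of `PointKernelK34Data`; soundness is `PCert.mBlockOK_sound`.
Estimated kernel time 180 s (7 theorems).
-/

set_option maxRecDepth 100000
set_option maxHeartbeats 0

namespace Literature.MathematicalPhysics.QuantumFieldTheory.ConformalBootstrap3D.PointKernelK34

open Literature.MathematicalPhysics.QuantumFieldTheory.ConformalBootstrap3D.PointKernel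

/-- (M) rows `[54, 56)` pass the kernel evaluator. [folklore] -/
theorem mBlock_54 : cert.mBlockOK mrows 54 56 = true := by
  decide +kernel

/-- (M) rows `[56, 58)` pass the kernel evaluator. [folklore] -/
theorem mBlock_56 : cert.mBlockOK mrows 56 58 = true := by
  decide +kernel

/-- (M) rows `[58, 60)` pass the kernel evaluator. [folklore] -/
theorem mBlock_58 : cert.mBlockOK mrows 58 60 = true := by
  decide +kernel

/-- (M) rows `[60, 62)` pass the kernel evaluator. [folklore] -/
theorem mBlock_60 : cert.mBlockOK mrows 60 62 = true := by
  decide +kernel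

/-- (M) rows `[62, 64)` pass the kernel evaluator. [folklore] -/
theorem mBlock_62 : cert.mBlockOK mrows 62 64 = true := by
  decide +kernel

/-- (M) rows `[64, 66)` pass the kernel evaluator. [folklore] -/
theorem mBlock_64 : cert.mBlockOK mrows 64 66 = true := by
  decide +kernel

/-- (M) rows `[66, 68)` pass the kernel evaluator. [folklore] -/
theorem mBlock_66 : cert.mBlockOK mrows 66 68 = true := by
  decide +kernel

end Literature.MathematicalPhysics.QuantumFieldTheory.ConformalBootstrap3D.PointKernelK34
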